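import Mathlib

/-!
# Hodge-locus census (cell `pub-hlocus`, engine B, abs-2 gen 49) — the parity lemma of §64

certified instances and evidence bearing on the general Hodge conjecture; no claim.

Helper file of `stmt-HodgeConjecture-16267` (computational census records; nothing here
is used by any route).  Setting (`data/abs/engineB/DERIVATIONS_engineB.md` §64, registered
in `ABSHODGE.md` LOG 2026-08-23T12:22:57Z before the W4 production rows): for a ζ₃-type
discriminant `D`, the reduction at the prime above 3 of the normalised CM embedding of a
class `𝔞` is `μ = x·i + y·π + w·iπ ∈ End(Ē)`, `Ē : y² = x³ − x` over `𝔽₉`,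
`End(Ē) = ℤ⟨1, i, (1+π)/2, i(1+π)/2⟩ ⊂ (−1,−3)_ℚ`; for odd `D` optimality forces `3 ∣ x`,
`y` odd, `x ≡ w (mod 2)` (§64.4).  The six elements of `End(Ē)ˣ/±1` act on `(x, y, w)` by
the maps of §64.6 (denominators cleared below: `γ(x,y,w) = (x', y', w')` is written with
`2x'`, `2w'`), and a `K₃^⊥`-class (one whose CM value lies in `ℚ₃(√3)`) satisfies
`γ(x, y, w) = (x, −y, w)` for some `γ` (§64.7).  The PARITY LEMMA says that then `3 ∣ w`,
i.e. the class lies in the REAL camp; with the level-2 input (H) of §64.3 this is the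
registered single-D E4 form for odd `D` (no `ℚ₃(√3)`-root of `H_D` at slope 3).
Also checked: the six maps preserve `y` up to sign and the form `x² + 3w²` (§64.6), so they
preserve the norm `x² + 3y² + 3w² = |D|`.
Evidence files: `data/abs/engineB/v3/xt/ta8B/CHECK-QUAT-W123.txt` (35/35 ζ₃-type `D`),
`GZ-CHECK-W123.txt` (985/985 same-type pairs, 84 000 root valuations).
-/

set_option linter.dupNamespace false

namespace Summit.HodgeConjecture.HodgeConjecture.HodgeLocus.Census.ParityLemmaB

/-- PARITY LEMMA (§64.7).  The hypothesis `h` says: one of the six unit conjugations of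
§64.6 (`γ = 1, ρ, ρ², i, iρ, iρ²`, in this order) maps `(x, y, w)` to `(x, -y, w)`, written
with the denominators 2 cleared (doubled target coordinates).  Conclusion: for odd `D` (so `y` odd and `3 ∣ x`), a `K₃^⊥`-witness forces
`3 ∣ w` — the class is in the REAL camp. -/
theorem three_dvd_w_of_perpWitness (x y w : ℤ) (hx : (3 : ℤ) ∣ x) (hy : Odd y)
    (h :  (    (y = -y)                                                    -- γ = 1
          ∨ (-(x + 3 * w) = 2 * x ∧ y = -y ∧ (x - w) = 2 * w)           -- γ = ρ
          ∨ ((-x + 3 * w) = 2 * x ∧ y = -y ∧ -(x + w) = 2 * w)          -- γ = ρ²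
          ∨ (-y = -y ∧ -w = w)                                          -- γ = i
          ∨ (-(x + 3 * w) = 2 * x ∧ -(x - w) = 2 * w)                   -- γ = iρ
          ∨ ((-x + 3 * w) = 2 * x ∧ (x + w) = 2 * w))                   -- γ = iρ²
    ) :
    (3 : ℤ) ∣ w := by
  obtain ⟨k, hk⟩ := hx
  obtain ⟨m, hm⟩ := hy
  rcases h with h | ⟨h1, h2, h3⟩ | ⟨h1, h2, h3⟩ | ⟨-, h2⟩ | ⟨h1, h2⟩ | ⟨h1, h2⟩
  · omega
  · omega
  · omega
  · exact ⟨0, by omega⟩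
  · exact ⟨-k, by omega⟩
  · exact ⟨k, by omega⟩

/-- The three `y`-fixing conjugations (`1, ρ, ρ²`) can never be the witness when `y ≠ 0`;
recorded separately because it is the step that uses `y` odd. -/
theorem perpWitness_in_i_coset (x y w : ℤ) (hy : y ≠ 0)
    (h :  (    (y = -y)                                                    -- γ = 1
          ∨ (-(x + 3 * w) = 2 * x ∧ y = -y ∧ (x - w) = 2 * w)           -- γ = ρ
          ∨ ((-x + 3 * w) = 2 * x ∧ y = -y ∧ -(x + w) = 2 * w)          -- γ = ρ²
          ∨ (-y = -y ∧ -w = w)                                          -- γ = i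
          ∨ (-(x + 3 * w) = 2 * x ∧ -(x - w) = 2 * w)                   -- γ = iρ
          ∨ ((-x + 3 * w) = 2 * x ∧ (x + w) = 2 * w))                   -- γ = iρ²
    ) :
    (-w = w) ∨ (-(x + 3 * w) = 2 * x ∧ -(x - w) = 2 * w) ∨ ((-x + 3 * w) = 2 * x ∧ (x + w) = 2 * w) := by
  rcases h with h | ⟨-, h2, -⟩ | ⟨-, h2, -⟩ | ⟨-, h2⟩ | h | h
  · omega
  · omega
  · omega
  · exact Or.inl h2
  · exact Or.inr (Or.inl h)
  · exact Or.inr (Or.inr h)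

/-- §64.6 sanity: conjugation by `ρ` — `(x, y, w) ↦ (-(x+3w)/2, y, (x-w)/2)` — preserves the
form `x² + 3w²` (stated with denominators cleared: `(2x')² + 3(2w')² = 4(x² + 3w²)`). -/
theorem rho_preserves_form (x w : ℤ) :
    (-(x + 3 * w)) ^ 2 + 3 * (x - w) ^ 2 = 4 * (x ^ 2 + 3 * w ^ 2) := by ring

/-- §64.6 sanity: conjugation by `ρ²` — `(x, y, w) ↦ ((-x+3w)/2, y, -(x+w)/2)`. -/
theorem rhoSq_preserves_form (x w : ℤ) :
    (-x + 3 * w) ^ 2 + 3 * (-(x + w)) ^ 2 = 4 * (x ^ 2 + 3 * w ^ 2) := by ring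

/-- §64.4: in a solution of `x² + 3y² + 3w² = 3d` with `3 ∣ x` and `d ≡ 1 (mod 3)`
(the ζ₃-type condition) exactly one of `y`, `w` is divisible by 3 — so every class has a
well-defined camp (REAL: `3 ∣ w`, IMAGINARY: `3 ∣ y`). -/
theorem camp_welldefined (x y w d : ℤ) (hx : (3 : ℤ) ∣ x) (hd : d % 3 = 1)
    (hn : x ^ 2 + 3 * y ^ 2 + 3 * w ^ 2 = 3 * d) : ((3 : ℤ) ∣ w) ↔ ¬ (3 : ℤ) ∣ y := by
  obtain ⟨k, rfl⟩ := hx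
  have h1 : 3 * k ^ 2 + y ^ 2 + w ^ 2 = d := by nlinarith
  have hy : y % 3 = 0 ∨ y % 3 = 1 ∨ y % 3 = 2 := by omega
  have hw : w % 3 = 0 ∨ w % 3 = 1 ∨ w % 3 = 2 := by omega
  have key : (y ^ 2 + w ^ 2) % 3 = 1 := by
    have : (y ^ 2 + w ^ 2) = d - 3 * k ^ 2 := by omega
    rw [this]; omega
  constructor
  · rintro ⟨a, rfl⟩ ⟨b, rfl⟩
    have : ((3 * b) ^ 2 + (3 * a) ^ 2) % 3 = 0 := by ring_nf; omega
    omega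
  · intro hy3
    by_contra hw3
    have hy' : y % 3 = 1 ∨ y % 3 = 2 := by
      rcases hy with h | h | h
      · exact absurd (Int.dvd_of_emod_eq_zero h) hy3
      · exact Or.inl h
      · exact Or.inr h
    have hw' : w % 3 = 1 ∨ w % 3 = 2 := by
      rcases hw with h | h | h
      · exact absurd (Int.dvd_of_emod_eq_zero h) hw3
      · exact Or.inl h
      · exact Or.inr h
    have hy2 : y ^ 2 % 3 = 1 := by
      rcases hy' with h | h
      · have : y = 3 * (y / 3) + 1 := by omega
        rw [this]; ring_nf; omega
      · have : y = 3 * (y / 3) + 2 := by omega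
        rw [this]; ring_nf; omega
    have hw2 : w ^ 2 % 3 = 1 := by
      rcases hw' with h | h
      · have : w = 3 * (w / 3) + 1 := by omega
        rw [this]; ring_nf; omega
      · have : w = 3 * (w / 3) + 2 := by omega
        rw [this]; ring_nf; omega
    omega

end Summit.HodgeConjecture.HodgeConjecture.HodgeLocus.Census.ParityLemmaB
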